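import Summits.AtomisticToContinuum.Crystallization.Theorems.BrittleRungDescentMieRungPeriodic
import Summits.AtomisticToContinuum.Crystallization.Theorems.ThreeConeCertificateKeplerBoundLocLimRemoval

/-!
# Route `BrittleRungDescent`, item `MieRung` (stmt-AtomisticToContinuum-10946): the energetic
# conjunct for a general Lennard-Jones-like pair potential, II — the thermodynamic limit

Part II of the generic-`V` series (see part I, `BrittleRungDescentMieRungPeriodic`, for the
hypotheses `hV0`, `hfar`, `h6`/`hA`, `hstab`).  For such a potential `V` on `ℝ³`:

* `groundStateEnergy_succ_le`, `groundStateEnergy_antitone`, `groundStateEnergy_nonpos` —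
  `N ↦ E_V(N)` is non-increasing (add a far particle: all new pair terms are `≤ 0`) and `≤ 0`;
* `iInf_le_groundStateEnergy_div` — `e_* ≤ E_V(N)/N` for `N ≥ 1` (periodisation, part I), where
  `e_* = ⨅_Q e_V(Q)` is the periodic infimum;
* `eventually_groundStateEnergy_div_le` — for every periodic `Q` and `ε > 0`, eventually
  `E_V(N)/N ≤ e_V(Q) + ε` (blocks of `Q` as trial states at the block sizes `#F·K³`, part I, and
  monotonicity in between);
* `tendsto_groundStateEnergy_div` — **`E_V(N)/N → e_*`**: the ground-state energy per particle
  converges to the infimum of the energy per particle over periodic configurations (the tree's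
  `crysEnergyLimit`, there for `lennardJones` only and via Fekete's lemma).

All `[folklore]` (Blanc–Lewin 2015, §1.3 (4), (8) and §2.1).
-/

noncomputable section

namespace Summit.AtomisticToContinuum.Crystallization.Theorems.MieRungEnergetic

open Literature.MathematicalPhysics.StatisticalMechanics
open Summit.AtomisticToContinuum.Crystallization.Theorems.ChargedEnergyGapNegative
open Summit.AtomisticToContinuum.Crystallization.Theorems.ChargedEnergyGapNegative.Blocks
open Filter Topology
open scoped BigOperators

variable {V : ℝ → ℝ} {A C : ℝ}

/-! ### Finite stability: `E_V(N)` is a genuine infimum -/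

/-- Under stability the energies of injective `N`-configurations are bounded below.
[folklore] -/
theorem bddBelow_interactionEnergy
    (hstab : ∀ (n : ℕ) (y : Fin n → E3), Function.Injective y →
      -(C * n) ≤ interactionEnergy V y) (N : ℕ) :
    BddBelow (Set.range fun x : {x : Fin N → E3 // Function.Injective x} =>
      interactionEnergy V x.1) :=
  ⟨-(C * N), by rintro _ ⟨x, rfl⟩; exact hstab N x.1 x.2⟩

/-- `E_V(N) ≤ 𝓔_V(x)` for every injective configuration `x`. [folklore] -/
theorem groundStateEnergy_le_of_stab
    (hstab : ∀ (n : ℕ) (y : Fin n → E3), Function.Injective y →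
      -(C * n) ≤ interactionEnergy V y) {N : ℕ} {x : Fin N → E3}
    (hx : Function.Injective x) : groundStateEnergy V 3 N ≤ interactionEnergy V x :=
  groundStateEnergy_le V (bddBelow_interactionEnergy hstab N) hx

/-- `−C·N ≤ E_V(N)`. [folklore] -/
theorem neg_mul_le_groundStateEnergy
    (hstab : ∀ (n : ℕ) (y : Fin n → E3), Function.Injective y →
      -(C * n) ≤ interactionEnergy V y) (N : ℕ) :
    -(C * N) ≤ groundStateEnergy V 3 N := by
  haveI := nonempty_injective_config (show 0 < 3 by norm_num) N
  exact le_ciInf fun x => hstab N x.1 x.2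

/-! ### Monotonicity of `N ↦ E_V(N)` -/

/-- **Adding a far particle does not raise the energy**: `E_V(N + 1) ≤ E_V(N)` (every injective
`N`-configuration extends by a point at distance `> 1` from all its points, where `V ≤ 0`).
[folklore] -/
theorem groundStateEnergy_succ_le (hV0 : V 0 = 0) (hfar : ∀ r, 1 ≤ r → V r ≤ 0)
    (hstab : ∀ (n : ℕ) (y : Fin n → E3), Function.Injective y →
      -(C * n) ≤ interactionEnergy V y) (N : ℕ) :
    groundStateEnergy V 3 (N + 1) ≤ groundStateEnergy V 3 N := by
  haveI := nonempty_injective_config (show 0 < 3 by norm_num) N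
  refine le_ciInf fun y => ?_
  obtain ⟨c, hc⟩ := KeplerBoundLocalLimit.exists_far_shift y.1 (fun _ : Fin 1 => (0 : E3))
  have hc' : ∀ k, 1 < dist (y.1 k) c := fun k => by simpa using hc k 0
  set x : Fin (N + 1) → E3 := Fin.cons c y.1 with hx
  have hnot : c ∉ Set.range y.1 := by
    rintro ⟨k, hk⟩
    have := hc' k
    rw [hk, dist_self] at this
    exact absurd this (by norm_num)
  have hinj : Function.Injective x := Fin.cons_injective_iff.2 ⟨hnot, y.2⟩
  have htail : x ∘ Fin.succAbove (0 : Fin (N + 1)) = y.1 := by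
    funext k
    simp [hx]
  have hE : interactionEnergy V x = interactionEnergy V y.1 + siteEnergy V x 0 := by
    have h := interactionEnergy_eq_succAbove_add_siteEnergy V hV0 x 0
    rwa [htail] at h
  have hsite : siteEnergy V x 0 ≤ 0 := by
    unfold siteEnergy
    refine Finset.sum_nonpos fun k hk => ?_
    have hk0 : k ≠ 0 := Finset.ne_of_mem_erase hk
    obtain ⟨j, rfl⟩ := Fin.exists_succ_eq.2 hk0
    have h0 : x 0 = c := by simp [hx]
    have h2 : x j.succ = y.1 j := by simp [hx]
    rw [h0, h2, dist_comm]
    exact hfar _ (hc' j).le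
  calc groundStateEnergy V 3 (N + 1) ≤ interactionEnergy V x :=
        groundStateEnergy_le_of_stab hstab hinj
    _ ≤ interactionEnergy V y.1 := by linarith

/-- `N ↦ E_V(N)` is non-increasing. [folklore] -/
theorem groundStateEnergy_antitone (hV0 : V 0 = 0) (hfar : ∀ r, 1 ≤ r → V r ≤ 0)
    (hstab : ∀ (n : ℕ) (y : Fin n → E3), Function.Injective y →
      -(C * n) ≤ interactionEnergy V y) :
    Antitone fun N : ℕ => groundStateEnergy V 3 N :=
  antitone_nat_of_succ_le fun N => groundStateEnergy_succ_le hV0 hfar hstab N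

/-- `E_V(N) ≤ 0` (`E_V(0) = E_V(1) = 0` and monotonicity). [folklore] -/
theorem groundStateEnergy_nonpos (hV0 : V 0 = 0) (hfar : ∀ r, 1 ≤ r → V r ≤ 0)
    (hstab : ∀ (n : ℕ) (y : Fin n → E3), Function.Injective y →
      -(C * n) ≤ interactionEnergy V y) (N : ℕ) :
    groundStateEnergy V 3 N ≤ 0 := by
  rcases Nat.eq_zero_or_pos N with rfl | hN
  · exact (groundStateEnergy_of_le_one V (zero_le_one : 0 ≤ 1)).le
  · calc groundStateEnergy V 3 N ≤ groundStateEnergy V 3 1 :=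
          groundStateEnergy_antitone hV0 hfar hstab hN
      _ = 0 := groundStateEnergy_of_le_one V le_rfl

/-! ### The lower bound `e_* ≤ E_V(N)/N` -/

/-- `N · e_* ≤ E_V(N)` with `e_* = ⨅_Q e_V(Q)` (periodisation of near-minimisers). [folklore] -/
theorem card_mul_iInf_le_groundStateEnergy (hV0 : V 0 = 0) (hfar : ∀ r, 1 ≤ r → V r ≤ 0)
    (h6 : ∀ r, 0 < r → -(A * r⁻¹ ^ 6) ≤ V r) (hA : 0 ≤ A)
    (hstab : ∀ (n : ℕ) (y : Fin n → E3), Function.Injective y →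
      -(C * n) ≤ interactionEnergy V y) (N : ℕ) :
    (N : ℝ) * (⨅ Q : PeriodicConfiguration 3, Q.energyPerParticle V) ≤
      groundStateEnergy V 3 N := by
  haveI := nonempty_injective_config (show 0 < 3 by norm_num) N
  exact le_ciInf fun x => card_mul_iInf_le_interactionEnergy hfar h6 hA
    (bddBelow_energyPerParticle hV0 hfar h6 hA hstab) x.2

/-- `e_* ≤ E_V(N)/N` for `N ≥ 1`. [folklore] -/
theorem iInf_le_groundStateEnergy_div (hV0 : V 0 = 0) (hfar : ∀ r, 1 ≤ r → V r ≤ 0)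
    (h6 : ∀ r, 0 < r → -(A * r⁻¹ ^ 6) ≤ V r) (hA : 0 ≤ A)
    (hstab : ∀ (n : ℕ) (y : Fin n → E3), Function.Injective y →
      -(C * n) ≤ interactionEnergy V y) {N : ℕ} (hN : 0 < N) :
    (⨅ Q : PeriodicConfiguration 3, Q.energyPerParticle V) ≤ groundStateEnergy V 3 N / N := by
  have hNr : (0 : ℝ) < N := by exact_mod_cast hN
  rw [le_div_iff₀ hNr, mul_comm]
  exact card_mul_iInf_le_groundStateEnergy hV0 hfar h6 hA hstab N

/-! ### The upper bound: blocks as trial states, all `N` -/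

/-- Elementary: for `K ≥ 1`, `(K+1)³ − K³ ≤ 3 (K+1)² ≤ … `, in the form
`((K + 1 : ℝ))³ ≤ K³ · (1 + 3/K)`… we use the cruder `(K+1)³ ≤ K³ + 7 K²` for `K ≥ 1`.
[folklore] -/
theorem succ_pow_three_le {K : ℕ} (hK : 1 ≤ K) : ((K : ℝ) + 1) ^ 3 ≤ (K : ℝ) ^ 3 + 7 * (K : ℝ) ^ 2 := by
  have hK' : (1 : ℝ) ≤ K := by exact_mod_cast hK
  nlinarith [hK', sq_nonneg ((K : ℝ) - 1)]

/-- **Trial-state upper bound, all `N`.** For every periodic `Q` and `ε > 0`, eventually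
`E_V(N)/N ≤ e_V(Q) + ε`: at the block sizes `n_K = #F·K³` this is part I
(`exists_block_energy_le`), and for `n_K ≤ N < n_{K+1}` one uses `E_V(N) ≤ E_V(n_K)`
(monotonicity) and `n_K/N → 1`. [folklore] -/
theorem eventually_groundStateEnergy_div_le (hV0 : V 0 = 0) (hfar : ∀ r, 1 ≤ r → V r ≤ 0)
    (h6 : ∀ r, 0 < r → -(A * r⁻¹ ^ 6) ≤ V r) (hA : 0 ≤ A)
    (hstab : ∀ (n : ℕ) (y : Fin n → E3), Function.Injective y →
      -(C * n) ≤ interactionEnergy V y)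
    (Q : PeriodicConfiguration 3) {ε : ℝ} (hε : 0 < ε) :
    ∀ᶠ N : ℕ in atTop, groundStateEnergy V 3 N / N ≤ Q.energyPerParticle V + ε := by
  classical
  set e : ℝ := Q.energyPerParticle V with he
  set a : ℝ := e + ε / 2 with ha
  set F : ℕ := Q.motif.card with hF
  have hF1 : 1 ≤ F := Q.motif_nonempty.card_pos
  have hFr : (1 : ℝ) ≤ F := by exact_mod_cast hF1
  obtain ⟨K₀, hK₀, hblock⟩ := exists_block_energy_le Q hV0 hfar h6 hA (show 0 < ε / 2 by positivity)
  -- the energy at the block sizes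
  have hEn : ∀ K, K₀ ≤ K → groundStateEnergy V 3 (F * K ^ 3) ≤ (F * K ^ 3 : ℕ) * a := by
    intro K hK
    have h3 : groundStateEnergy V 3 (Fintype.card (BIdx Q K)) ≤
        (Fintype.card (BIdx Q K) : ℝ) * (Q.energyPerParticle V + ε / 2) :=
      (groundStateEnergy_le_of_stab hstab (blockConfig_injective Q K)).trans (hblock K hK)
    rw [card_BIdx] at h3
    exact h3
  by_cases ha0 : 0 ≤ a
  · -- trivial case: `E ≤ 0 ≤ N (e + ε)`
    refine Filter.Eventually.of_forall fun N => ?_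
    have h1 : groundStateEnergy V 3 N / N ≤ 0 :=
      div_nonpos_of_nonpos_of_nonneg (groundStateEnergy_nonpos hV0 hfar hstab N) (Nat.cast_nonneg N)
    have h2 : 0 ≤ e + ε := by rw [ha] at ha0; linarith
    linarith
  · push Not at ha0
    -- `K₁`: beyond `K₀`, and so large that `7 (-a) ≤ (ε/2) K`
    obtain ⟨K₁', hK₁'⟩ := exists_nat_gt (7 * (-a) / (ε / 2))
    set K₁ : ℕ := max K₀ (max K₁' 1) with hK₁
    have hK₁K₀ : K₀ ≤ K₁ := le_max_left _ _
    have hK₁1 : 1 ≤ K₁ := (le_max_right _ _).trans (le_max_right _ _)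
    have hK₁' : 7 * (-a) / (ε / 2) < K₁ := by
      have : (K₁' : ℝ) ≤ K₁ := by exact_mod_cast (le_max_left _ _).trans (le_max_right K₀ _)
      linarith
    refine Filter.eventually_atTop.2 ⟨F * K₁ ^ 3, fun N hN => ?_⟩
    -- the largest `K` with `F K³ ≤ N`
    set K : ℕ := Nat.findGreatest (fun k => F * k ^ 3 ≤ N) N with hKdef
    have hK₁N : K₁ ≤ N := by
      calc K₁ = 1 * K₁ ^ 1 := by ring
        _ ≤ F * K₁ ^ 3 := Nat.mul_le_mul hF1 (Nat.pow_le_pow_right hK₁1 (by norm_num))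
        _ ≤ N := hN
    have hK₁K : K₁ ≤ K := Nat.le_findGreatest hK₁N hN
    have hKK₀ : K₀ ≤ K := hK₁K₀.trans hK₁K
    have hK1 : 1 ≤ K := hK₁1.trans hK₁K
    have hKN : F * K ^ 3 ≤ N := Nat.findGreatest_spec (P := fun k => F * k ^ 3 ≤ N) hK₁N hN
    have hNK : N < F * (K + 1) ^ 3 := by
      by_contra hle
      push Not at hle
      have hKle : K ≤ N := Nat.findGreatest_le N
      rcases Nat.lt_or_ge K N with hlt | hge
      · exact Nat.findGreatest_is_greatest (Nat.lt_succ_self K) (Nat.succ_le_of_lt hlt) hle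
      · have hKeq : K = N := le_antisymm hKle hge
        have h2 : N < F * (K + 1) ^ 3 :=
          calc N < N + 1 := Nat.lt_succ_self N
            _ = 1 * (N + 1) ^ 1 := by ring
            _ ≤ F * (K + 1) ^ 3 := by
                rw [hKeq]; exact Nat.mul_le_mul hF1 (Nat.pow_le_pow_right (Nat.succ_pos N) (by norm_num))
        exact absurd hle (not_le.2 h2)
    -- real-number versions
    have hNpos : 0 < N := lt_of_lt_of_le (Nat.mul_pos hF1 (pow_pos hK₁1 3)) hN
    have hNr : (0 : ℝ) < N := by exact_mod_cast hNpos
    have hKr1 : (1 : ℝ) ≤ K := by exact_mod_cast hK1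
    have hnr : ((F * K ^ 3 : ℕ) : ℝ) = (F : ℝ) * (K : ℝ) ^ 3 := by push_cast; ring
    have hKNr : (F : ℝ) * (K : ℝ) ^ 3 ≤ N := by rw [← hnr]; exact_mod_cast hKN
    have hNKr : (N : ℝ) < (F : ℝ) * ((K : ℝ) + 1) ^ 3 := by
      have : ((F * (K + 1) ^ 3 : ℕ) : ℝ) = (F : ℝ) * ((K : ℝ) + 1) ^ 3 := by push_cast; ring
      rw [← this]; exact_mod_cast hNK
    -- `E(N) ≤ E(n_K) ≤ n_K · a`
    have hE1 : groundStateEnergy V 3 N ≤ (F : ℝ) * (K : ℝ) ^ 3 * a := by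
      have h1 := groundStateEnergy_antitone hV0 hfar hstab hKN
      have h2 := hEn K hKK₀
      rw [hnr] at h2
      exact h1.trans h2
    -- the gap `N − n_K ≤ 7 F K²`, and `K ≥ K₁ > 14(-a)/ε`
    have hgap : (N : ℝ) - (F : ℝ) * (K : ℝ) ^ 3 ≤ (F : ℝ) * (7 * (K : ℝ) ^ 2) := by
      have := succ_pow_three_le hK1
      nlinarith
    have hK₁r : 7 * (-a) / (ε / 2) < K := by
      have : (K₁ : ℝ) ≤ K := by exact_mod_cast hK₁K
      linarith
    have hK₁r' : 7 * (-a) < (ε / 2) * K := by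
      rw [div_lt_iff₀ (by positivity)] at hK₁r
      linarith
    -- conclude: `E(N)/N ≤ a · n_K/N = a + (-a)(N − n_K)/N ≤ a + (-a)·7FK²/(FK³) ≤ a + ε/2`
    rw [div_le_iff₀ hNr]
    have hkey : (F : ℝ) * (K : ℝ) ^ 3 * a ≤ (e + ε) * N := by
      have h3 : (-a) * ((N : ℝ) - (F : ℝ) * (K : ℝ) ^ 3) ≤ (-a) * ((F : ℝ) * (7 * (K : ℝ) ^ 2)) :=
        mul_le_mul_of_nonneg_left hgap (by linarith)
      have h4 : (-a) * ((F : ℝ) * (7 * (K : ℝ) ^ 2)) ≤ (ε / 2) * ((F : ℝ) * (K : ℝ) ^ 3) := by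
        have h5 : (-a) * 7 * (K : ℝ) ^ 2 ≤ (ε / 2) * (K : ℝ) ^ 3 := by nlinarith
        nlinarith
      have h6' : (ε / 2) * ((F : ℝ) * (K : ℝ) ^ 3) ≤ (ε / 2) * N :=
        mul_le_mul_of_nonneg_left hKNr (by positivity)
      rw [ha] at h3 h4 ⊢
      nlinarith
    exact hE1.trans hkey

/-! ### The thermodynamic limit -/

/-- **`E_V(N)/N → e_* = ⨅_Q e_V(Q)`**: the ground-state energy per particle converges to the
infimum of the energy per particle over the periodic configurations of `ℝ³`. [folklore] -/
theorem tendsto_groundStateEnergy_div (hV0 : V 0 = 0) (hfar : ∀ r, 1 ≤ r → V r ≤ 0)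
    (h6 : ∀ r, 0 < r → -(A * r⁻¹ ^ 6) ≤ V r) (hA : 0 ≤ A)
    (hstab : ∀ (n : ℕ) (y : Fin n → E3), Function.Injective y →
      -(C * n) ≤ interactionEnergy V y) :
    Tendsto (fun N : ℕ => groundStateEnergy V 3 N / N) atTop
      (𝓝 (⨅ Q : PeriodicConfiguration 3, Q.energyPerParticle V)) := by
  set eStarV : ℝ := ⨅ Q : PeriodicConfiguration 3, Q.energyPerParticle V with hes
  rw [tendsto_order]
  refine ⟨fun b hb => ?_, fun b hb => ?_⟩
  · refine Filter.eventually_atTop.2 ⟨1, fun N hN => ?_⟩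
    exact hb.trans_le (iInf_le_groundStateEnergy_div hV0 hfar h6 hA hstab hN)
  · have hlt : eStarV < eStarV + (b - eStarV) / 2 := by linarith
    obtain ⟨Q, hQ⟩ := exists_lt_of_ciInf_lt hlt
    have hε : 0 < (b - eStarV) / 4 := by linarith
    filter_upwards [eventually_groundStateEnergy_div_le hV0 hfar h6 hA hstab Q hε] with N hN
    linarith

/-- The limit is at most every periodic energy per particle and at least `−C`. [folklore] -/
theorem iInf_mem_Icc (hV0 : V 0 = 0) (hfar : ∀ r, 1 ≤ r → V r ≤ 0)
    (h6 : ∀ r, 0 < r → -(A * r⁻¹ ^ 6) ≤ V r) (hA : 0 ≤ A)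
    (hstab : ∀ (n : ℕ) (y : Fin n → E3), Function.Injective y →
      -(C * n) ≤ interactionEnergy V y) (Q : PeriodicConfiguration 3) :
    (⨅ Q : PeriodicConfiguration 3, Q.energyPerParticle V) ∈
      Set.Icc (-C) (Q.energyPerParticle V) :=
  ⟨neg_le_iInf_energyPerParticle hV0 hfar h6 hA hstab,
    iInf_le_energyPerParticle Q hV0 hfar h6 hA hstab⟩

end Summit.AtomisticToContinuum.Crystallization.Theorems.MieRungEnergetic

end
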